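import Mathlib

/-!
# `TropicalB` (stmt-ValiantsHypothesis-19771) — the LINEAR COMPARABILITY LAW, part 1: adjacent record pairs and flips

Helper file for the crux `Theses.KPlusLogSqLaw.TropicalB` (`--supports stmt-ValiantsHypothesis-19771`), cell `pub-symmetroid`,
seat val-sym-trop-p5 (g5, refuter-adjacent lane).  HONEST FRAMING: pure finite combinatorics (no design, no tropical object) —
the two counting tools of the linear comparability law (`…TropicalBComparabilityLinear`, which removes the logarithm from the
tree's COMPARABILITY-SUM LAW `…TropicalBComparabilitySum.card_dominant_le`, `(N+U)·L·(⌊log₂ L⌋+1) ↦ (3(N+U)+1)·L`).  Nothing here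
bears on `TropicalB` in its window, `MatrixDescartes` (stmt-ValiantsHypothesis-18050) or VP ≠ VNP.

## Adjacent pairs (§1)
For two sets of positions `A, B ⊆ [0, L)` (in part 3: the prefix-records of the first register and the suffix-records of the
second at one slope), the pair `(y, p)` is ADJACENT if `y ∈ A`, `p ∈ B`, `y < p` and no element of `A ∪ B` lies strictly between
(written out as a conjunction everywhere; this file introduces no definitions).  An adjacent pair is determined by either
position (`snd_eq_of_adjacent`, `fst_eq_of_adjacent`), two different adjacent pairs have disjoint interiors
(`eq_of_adjacent_of_mem_interior`), hence there are at most `L` of them (`card_adjacent_le`), and — the tool — **the adjacent pairs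
of `(A', B')` that are not adjacent pairs of `(A, B)` number at most `#{z : z ∈ A ↮ z ∈ A'} + #{z : z ∈ B ↮ z ∈ B'}`**
(`card_adjacent_sdiff_le`: blame the new first position, the new second position, or a record that vanished from the interior;
injective by the disjointness of interiors).

## Flips (§2)
A predicate on times `k < n` that is INTERVAL-SHAPED (true at `a < c` ⇒ true at every `b` between) changes truth value at most
twice (`card_flips_le_two`); an OR of `N` such predicates at most `2N` times (`card_flips_exists_le`); and if every position's
membership in `A k` flips at most `2M` times then `Σ_{k<n'} #{z : z ∈ A k ↮ z ∈ A (k+1)} ≤ 2M·L` (`sum_card_flip_le`, double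
counting). [folklore-level counting]
-/

set_option linter.dupNamespace false
set_option autoImplicit false

namespace Summit.ValiantsHypothesis.ValiantsHypothesis.Theorems.KPlusLogSqLaw.ComparabilityLinear

open Finset

variable {L : ℕ}

/-! ## 1. Adjacent pairs of a configuration `(A, B)` -/

/-- the second position of an adjacent pair is determined by the first. -/
theorem snd_eq_of_adjacent {A B : Finset (Fin L)} {y p p' : Fin L}
    (h : y ∈ A ∧ p ∈ B ∧ y < p ∧ ∀ z : Fin L, y < z → z < p → z ∉ A ∧ z ∉ B)
    (h' : y ∈ A ∧ p' ∈ B ∧ y < p' ∧ ∀ z : Fin L, y < z → z < p' → z ∉ A ∧ z ∉ B) : p = p' := by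
  rcases lt_trichotomy p p' with hlt | heq | hgt
  · exact absurd h.2.1 (h'.2.2.2 p h.2.2.1 hlt).2
  · exact heq
  · exact absurd h'.2.1 (h.2.2.2 p' h'.2.2.1 hgt).2

/-- the first position of an adjacent pair is determined by the second. -/
theorem fst_eq_of_adjacent {A B : Finset (Fin L)} {y y' p : Fin L}
    (h : y ∈ A ∧ p ∈ B ∧ y < p ∧ ∀ z : Fin L, y < z → z < p → z ∉ A ∧ z ∉ B)
    (h' : y' ∈ A ∧ p ∈ B ∧ y' < p ∧ ∀ z : Fin L, y' < z → z < p → z ∉ A ∧ z ∉ B) : y = y' := by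
  rcases lt_trichotomy y y' with hlt | heq | hgt
  · exact absurd h'.1 (h.2.2.2 y' hlt h'.2.2.1).1
  · exact heq
  · exact absurd h.1 (h'.2.2.2 y hgt h.2.2.1).1

/-- two adjacent pairs of one configuration with a common interior point coincide (disjoint interiors). -/
theorem eq_of_adjacent_of_mem_interior {A B : Finset (Fin L)} {y p y' p' z : Fin L}
    (h : y ∈ A ∧ p ∈ B ∧ y < p ∧ ∀ z : Fin L, y < z → z < p → z ∉ A ∧ z ∉ B)
    (h' : y' ∈ A ∧ p' ∈ B ∧ y' < p' ∧ ∀ z : Fin L, y' < z → z < p' → z ∉ A ∧ z ∉ B)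
    (hz : y < z ∧ z < p) (hz' : y' < z ∧ z < p') : y = y' ∧ p = p' := by
  have hy : y = y' := by
    rcases lt_trichotomy y y' with hlt | heq | hgt
    · exfalso
      have : p ≤ y' := le_of_not_gt fun hlt' => (h.2.2.2 y' hlt hlt').1 h'.1
      exact absurd (lt_of_lt_of_le hz.2 this) (not_lt.2 hz'.1.le)
    · exact heq
    · exfalso
      have : p' ≤ y := le_of_not_gt fun hlt' => (h'.2.2.2 y hgt hlt').1 h.1
      exact absurd (lt_of_lt_of_le hz'.2 this) (not_lt.2 hz.1.le)
  subst hy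
  exact ⟨rfl, snd_eq_of_adjacent h h'⟩

/-- a configuration on `L` positions has at most `L` adjacent pairs. -/
theorem card_adjacent_le (A B : Finset (Fin L)) :
    ((Finset.univ : Finset (Fin L × Fin L)).filter (fun π => π.1 ∈ A ∧ π.2 ∈ B ∧ π.1 < π.2 ∧
      ∀ z : Fin L, π.1 < z → z < π.2 → z ∉ A ∧ z ∉ B)).card ≤ L := by
  classical
  set S := (Finset.univ : Finset (Fin L × Fin L)).filter (fun π => π.1 ∈ A ∧ π.2 ∈ B ∧ π.1 < π.2 ∧
      ∀ z : Fin L, π.1 < z → z < π.2 → z ∉ A ∧ z ∉ B) with hS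
  have h := Finset.card_le_card_of_injOn (s := S) (t := (Finset.univ : Finset (Fin L))) Prod.fst
    (fun π _ => Finset.mem_coe.2 (Finset.mem_univ _)) ?_
  · simpa using h
  · intro π hπ π' hπ' he
    have h1 := (Finset.mem_filter.1 (Finset.mem_coe.1 hπ)).2
    have h2 := (Finset.mem_filter.1 (Finset.mem_coe.1 hπ')).2
    have he' : π.1 = π'.1 := he
    rw [he'] at h1
    exact Prod.ext he' (snd_eq_of_adjacent h1 h2)

/-- **New adjacent pairs are paid for by flips.**  The adjacent pairs of `(A', B')` that are not adjacent pairs of `(A, B)` number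
at most `#{z : ¬(z ∈ A ↔ z ∈ A')} + #{z : ¬(z ∈ B ↔ z ∈ B')}`. -/
theorem card_adjacent_sdiff_le (A B A' B' : Finset (Fin L)) :
    ((Finset.univ : Finset (Fin L × Fin L)).filter (fun π => π.1 ∈ A' ∧ π.2 ∈ B' ∧ π.1 < π.2 ∧
        ∀ z : Fin L, π.1 < z → z < π.2 → z ∉ A' ∧ z ∉ B') \
      (Finset.univ : Finset (Fin L × Fin L)).filter (fun π => π.1 ∈ A ∧ π.2 ∈ B ∧ π.1 < π.2 ∧
        ∀ z : Fin L, π.1 < z → z < π.2 → z ∉ A ∧ z ∉ B)).card ≤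
    ((Finset.univ : Finset (Fin L)).filter (fun z => ¬ (z ∈ A ↔ z ∈ A'))).card +
    ((Finset.univ : Finset (Fin L)).filter (fun z => ¬ (z ∈ B ↔ z ∈ B'))).card := by
  classical
  set New := ((Finset.univ : Finset (Fin L × Fin L)).filter (fun π => π.1 ∈ A' ∧ π.2 ∈ B' ∧ π.1 < π.2 ∧
        ∀ z : Fin L, π.1 < z → z < π.2 → z ∉ A' ∧ z ∉ B') \
      (Finset.univ : Finset (Fin L × Fin L)).filter (fun π => π.1 ∈ A ∧ π.2 ∈ B ∧ π.1 < π.2 ∧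
        ∀ z : Fin L, π.1 < z → z < π.2 → z ∉ A ∧ z ∉ B)) with hNew
  set FA := (Finset.univ : Finset (Fin L)).filter (fun z => ¬ (z ∈ A ↔ z ∈ A')) with hFA
  set FB := (Finset.univ : Finset (Fin L)).filter (fun z => ¬ (z ∈ B ↔ z ∈ B')) with hFB
  have hmem : ∀ π ∈ New, (π.1 ∈ A' ∧ π.2 ∈ B' ∧ π.1 < π.2 ∧ ∀ z : Fin L, π.1 < z → z < π.2 → z ∉ A' ∧ z ∉ B') ∧
      ¬ (π.1 ∈ A ∧ π.2 ∈ B ∧ π.1 < π.2 ∧ ∀ z : Fin L, π.1 < z → z < π.2 → z ∉ A ∧ z ∉ B) := by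
    intro π hπ
    rw [hNew, Finset.mem_sdiff, Finset.mem_filter, Finset.mem_filter] at hπ
    exact ⟨hπ.1.2, fun h => hπ.2 ⟨Finset.mem_univ _, h⟩⟩
  have hmemFA : ∀ z, z ∈ FA ↔ ¬ (z ∈ A ↔ z ∈ A') := fun z => by rw [hFA, Finset.mem_filter]; simp
  have hmemFB : ∀ z, z ∈ FB ↔ ¬ (z ∈ B ↔ z ∈ B') := fun z => by rw [hFB, Finset.mem_filter]; simp
  -- an interior witness for the pairs whose endpoints did not move
  have hwit : ∀ π ∈ New, π.1 ∈ A → π.2 ∈ B →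
      ∃ z : Fin L, π.1 < z ∧ z < π.2 ∧ (z ∈ A ∨ z ∈ B) ∧ z ∉ A' ∧ z ∉ B' := by
    intro π hπ hyA hpB
    obtain ⟨hadj', hnadj⟩ := hmem π hπ
    by_contra hcon
    push Not at hcon
    apply hnadj
    refine ⟨hyA, hpB, hadj'.2.2.1, fun z hyz hzp => ?_⟩
    have h4 := hadj'.2.2.2 z hyz hzp
    by_cases hzA : z ∈ A
    · exact absurd (hcon z hyz hzp (Or.inl hzA)) (by simp [h4.1, h4.2])
    · by_cases hzB : z ∈ B
      · exact absurd (hcon z hyz hzp (Or.inr hzB)) (by simp [h4.1, h4.2])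
      · exact ⟨hzA, hzB⟩
  -- the blame maps
  let gA : Fin L × Fin L → Fin L := fun π =>
    if π.1 ∉ A then π.1 else
      if h : ∃ z : Fin L, π.1 < z ∧ z < π.2 ∧ (z ∈ A ∨ z ∈ B) ∧ z ∉ A' ∧ z ∉ B' then h.choose else π.1
  let gB : Fin L × Fin L → Fin L := fun π =>
    if π.2 ∉ B then π.2 else
      if h : ∃ z : Fin L, π.1 < z ∧ z < π.2 ∧ (z ∈ A ∨ z ∈ B) ∧ z ∉ A' ∧ z ∉ B' then h.choose else π.2
  -- split `New` into the part blamed on `A` and the part blamed on `B`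
  let NA := New.filter (fun π => π.1 ∉ A ∨ (π.1 ∈ A ∧ π.2 ∈ B ∧ gA π ∈ A))
  let NB := New.filter (fun π => ¬ (π.1 ∉ A ∨ (π.1 ∈ A ∧ π.2 ∈ B ∧ gA π ∈ A)))
  have hsplit : New.card = NA.card + NB.card := (Finset.card_filter_add_card_filter_not _).symm
  have hgAwit : ∀ π ∈ New, π.1 ∈ A → π.2 ∈ B →
      π.1 < gA π ∧ gA π < π.2 ∧ (gA π ∈ A ∨ gA π ∈ B) ∧ gA π ∉ A' ∧ gA π ∉ B' := by
    intro π hπ hyA hpB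
    have hex := hwit π hπ hyA hpB
    have : gA π = hex.choose := by
      simp only [gA, hyA, not_true_eq_false, if_false, dif_pos hex]
    rw [this]; exact hex.choose_spec
  have hgBwit : ∀ π ∈ New, π.1 ∈ A → π.2 ∈ B → gB π = gA π := by
    intro π hπ hyA hpB
    have hex := hwit π hπ hyA hpB
    simp only [gA, gB, hyA, hpB, not_true_eq_false, if_false, dif_pos hex]
  -- (1) `gA` maps `NA` injectively into `FA`
  have hA : NA.card ≤ FA.card := by
    refine Finset.card_le_card_of_injOn gA (fun π hπ => ?_) ?_
    · have hπ' := Finset.mem_filter.1 (Finset.mem_coe.1 hπ)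
      obtain ⟨hπN, hcase⟩ := hπ'
      have hadj' := (hmem π hπN).1
      rw [Finset.mem_coe, hmemFA]
      rcases hcase with hy | ⟨hyA, hpB, hgin⟩
      · have : gA π = π.1 := by simp only [gA, hy, not_false_eq_true, if_true]
        rw [this]; simp [hy, hadj'.1]
      · have hw := hgAwit π hπN hyA hpB
        simp [hgin, hw.2.2.2.1]
    · intro π hπ π' hπ' he
      have hπ1 := Finset.mem_filter.1 (Finset.mem_coe.1 hπ)
      have hπ2 := Finset.mem_filter.1 (Finset.mem_coe.1 hπ')
      have hadj1 := (hmem π hπ1.1).1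
      have hadj2 := (hmem π' hπ2.1).1
      rcases hπ1.2 with hy1 | ⟨hyA1, hpB1, hg1⟩ <;> rcases hπ2.2 with hy2 | ⟨hyA2, hpB2, hg2⟩
      · have e1 : gA π = π.1 := by simp only [gA, hy1, not_false_eq_true, if_true]
        have e2 : gA π' = π'.1 := by simp only [gA, hy2, not_false_eq_true, if_true]
        rw [e1, e2] at he
        have hadj1' := hadj1; rw [he] at hadj1'
        exact Prod.ext he (snd_eq_of_adjacent hadj1' hadj2)
      · exfalso
        have e1 : gA π = π.1 := by simp only [gA, hy1, not_false_eq_true, if_true]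
        rw [← he, e1] at hg2
        exact hy1 hg2
      · exfalso
        have e2 : gA π' = π'.1 := by simp only [gA, hy2, not_false_eq_true, if_true]
        rw [he, e2] at hg1
        exact hy2 hg1
      · have hw1 := hgAwit π hπ1.1 hyA1 hpB1
        have hw2 := hgAwit π' hπ2.1 hyA2 hpB2
        rw [he] at hw1
        obtain ⟨e1, e2⟩ := eq_of_adjacent_of_mem_interior hadj1 hadj2 ⟨hw1.1, hw1.2.1⟩ ⟨hw2.1, hw2.2.1⟩
        exact Prod.ext e1 e2
  -- (2) `gB` maps `NB` injectively into `FB`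
  have hNBmem : ∀ π ∈ NB, π.1 ∈ A ∧ (π.2 ∉ B ∨ (π.2 ∈ B ∧ gA π ∈ B ∧ gA π ∉ A)) := by
    intro π hπ
    obtain ⟨hπN, hcase⟩ := Finset.mem_filter.1 hπ
    push Not at hcase
    obtain ⟨hyA, hrest⟩ := hcase
    refine ⟨hyA, ?_⟩
    by_cases hpB : π.2 ∈ B
    · right
      have hw := hgAwit π hπN hyA hpB
      have hgnA := hrest hyA hpB
      rcases hw.2.2.1 with h | h
      · exact absurd h hgnA
      · exact ⟨hpB, h, hgnA⟩
    · exact Or.inl hpB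
  have hB : NB.card ≤ FB.card := by
    refine Finset.card_le_card_of_injOn gB (fun π hπ => ?_) ?_
    · have hπN := (Finset.mem_filter.1 (Finset.mem_coe.1 hπ)).1
      obtain ⟨hyA, hcase⟩ := hNBmem π (Finset.mem_coe.1 hπ)
      have hadj' := (hmem π hπN).1
      rw [Finset.mem_coe, hmemFB]
      rcases hcase with hp | ⟨hpB, hgin, -⟩
      · have : gB π = π.2 := by simp only [gB, hp, not_false_eq_true, if_true]
        rw [this]; simp [hp, hadj'.2.1]
      · have hw := hgAwit π hπN hyA hpB
        rw [hgBwit π hπN hyA hpB]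
        simp [hgin, hw.2.2.2.2]
    · intro π hπ π' hπ' he
      have hπN1 := (Finset.mem_filter.1 (Finset.mem_coe.1 hπ)).1
      have hπN2 := (Finset.mem_filter.1 (Finset.mem_coe.1 hπ')).1
      obtain ⟨hyA1, hc1⟩ := hNBmem π (Finset.mem_coe.1 hπ)
      obtain ⟨hyA2, hc2⟩ := hNBmem π' (Finset.mem_coe.1 hπ')
      have hadj1 := (hmem π hπN1).1
      have hadj2 := (hmem π' hπN2).1
      rcases hc1 with hp1 | ⟨hpB1, hg1, -⟩ <;> rcases hc2 with hp2 | ⟨hpB2, hg2, -⟩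
      · have e1 : gB π = π.2 := by simp only [gB, hp1, not_false_eq_true, if_true]
        have e2 : gB π' = π'.2 := by simp only [gB, hp2, not_false_eq_true, if_true]
        rw [e1, e2] at he
        have hadj1' := hadj1; rw [he] at hadj1'
        exact Prod.ext (fst_eq_of_adjacent hadj1' hadj2) he
      · exfalso
        have e1 : gB π = π.2 := by simp only [gB, hp1, not_false_eq_true, if_true]
        rw [he, hgBwit π' hπN2 hyA2 hpB2] at e1
        rw [e1] at hg2
        exact hp1 hg2
      · exfalso
        have e2 : gB π' = π'.2 := by simp only [gB, hp2, not_false_eq_true, if_true]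
        rw [← he, hgBwit π hπN1 hyA1 hpB1] at e2
        rw [e2] at hg1
        exact hp2 hg1
      · have hw1 := hgAwit π hπN1 hyA1 hpB1
        have hw2 := hgAwit π' hπN2 hyA2 hpB2
        rw [hgBwit π hπN1 hyA1 hpB1, hgBwit π' hπN2 hyA2 hpB2] at he
        rw [he] at hw1
        obtain ⟨e1, e2⟩ := eq_of_adjacent_of_mem_interior hadj1 hadj2 ⟨hw1.1, hw1.2.1⟩ ⟨hw2.1, hw2.2.1⟩
        exact Prod.ext e1 e2
  rw [hsplit]
  exact Nat.add_le_add hA hB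

/-! ## 2. Flips of interval-shaped predicates, and their double counting -/

/-- an INTERVAL-SHAPED predicate (true at `a` and `c` ⇒ true in between) changes truth value at most twice before time `n`. -/
theorem card_flips_le_two (n : ℕ) (Q : ℕ → Prop) [DecidablePred Q]
    (hQ : ∀ a b c : ℕ, a < b → b < c → c < n → Q a → Q c → Q b) :
    ((Finset.range n).filter (fun k => k + 1 < n ∧ ¬ (Q k ↔ Q (k + 1)))).card ≤ 2 := by
  classical
  have hcov : (Finset.range n).filter (fun k => k + 1 < n ∧ ¬ (Q k ↔ Q (k + 1))) ⊆
      (Finset.range n).filter (fun k => k + 1 < n ∧ ¬ Q k ∧ Q (k + 1)) ∪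
      (Finset.range n).filter (fun k => k + 1 < n ∧ Q k ∧ ¬ Q (k + 1)) := by
    intro k hk
    simp only [Finset.mem_filter, Finset.mem_union, Finset.mem_range] at hk ⊢
    by_cases h : Q k
    · exact Or.inr ⟨hk.1, hk.2.1, h, fun h' => hk.2.2 ⟨fun _ => h', fun _ => h⟩⟩
    · exact Or.inl ⟨hk.1, hk.2.1, h, by_contra fun h' => hk.2.2 ⟨fun x => absurd x h, fun x => absurd x h'⟩⟩
  have hup : ((Finset.range n).filter (fun k => k + 1 < n ∧ ¬ Q k ∧ Q (k + 1))).card ≤ 1 := by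
    refine Finset.card_le_one.2 ?_
    intro a ha b hb
    simp only [Finset.mem_filter, Finset.mem_range] at ha hb
    by_contra hab
    rcases lt_or_gt_of_ne hab with h | h
    · rcases Nat.lt_or_ge (a + 1) b with hlt | hge
      · exact hb.2.2.1 (hQ (a + 1) b (b + 1) hlt (Nat.lt_succ_self b) hb.2.1 ha.2.2.2 hb.2.2.2)
      · have e : b = a + 1 := by omega
        exact hb.2.2.1 (by rw [e]; exact ha.2.2.2)
    · rcases Nat.lt_or_ge (b + 1) a with hlt | hge
      · exact ha.2.2.1 (hQ (b + 1) a (a + 1) hlt (Nat.lt_succ_self a) ha.2.1 hb.2.2.2 ha.2.2.2)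
      · have e : a = b + 1 := by omega
        exact ha.2.2.1 (by rw [e]; exact hb.2.2.2)
  have hdown : ((Finset.range n).filter (fun k => k + 1 < n ∧ Q k ∧ ¬ Q (k + 1))).card ≤ 1 := by
    refine Finset.card_le_one.2 ?_
    intro a ha b hb
    simp only [Finset.mem_filter, Finset.mem_range] at ha hb
    by_contra hab
    rcases lt_or_gt_of_ne hab with h | h
    · rcases Nat.lt_or_ge (a + 1) b with hlt | hge
      · exact ha.2.2.2 (hQ a (a + 1) b (Nat.lt_succ_self a) hlt (by omega) ha.2.2.1 hb.2.2.1)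
      · have e : b = a + 1 := by omega
        exact ha.2.2.2 (by rw [← e]; exact hb.2.2.1)
    · rcases Nat.lt_or_ge (b + 1) a with hlt | hge
      · exact hb.2.2.2 (hQ b (b + 1) a (Nat.lt_succ_self b) hlt (by omega) hb.2.2.1 ha.2.2.1)
      · have e : a = b + 1 := by omega
        exact hb.2.2.2 (by rw [← e]; exact ha.2.2.1)
  calc ((Finset.range n).filter (fun k => k + 1 < n ∧ ¬ (Q k ↔ Q (k + 1)))).card ≤ _ := Finset.card_le_card hcov
    _ ≤ _ := Finset.card_union_le _ _
    _ ≤ 1 + 1 := Nat.add_le_add hup hdown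

/-- an OR of `N` interval-shaped predicates changes truth value at most `2N` times before time `n`. -/
theorem card_flips_exists_le (n N : ℕ) (Q : Fin N → ℕ → Prop) [∀ j, DecidablePred (Q j)]
    [DecidablePred (fun k => ∃ j, Q j k)]
    (hQ : ∀ j, ∀ a b c : ℕ, a < b → b < c → c < n → Q j a → Q j c → Q j b) :
    ((Finset.range n).filter (fun k => k + 1 < n ∧ ¬ ((∃ j, Q j k) ↔ (∃ j, Q j (k + 1))))).card ≤ 2 * N := by
  classical
  have hcov : (Finset.range n).filter (fun k => k + 1 < n ∧ ¬ ((∃ j, Q j k) ↔ (∃ j, Q j (k + 1)))) ⊆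
      (Finset.univ : Finset (Fin N)).biUnion
        (fun j => (Finset.range n).filter (fun k => k + 1 < n ∧ ¬ (Q j k ↔ Q j (k + 1)))) := by
    intro k hk
    simp only [Finset.mem_filter, Finset.mem_range, Finset.mem_biUnion, Finset.mem_univ, true_and] at hk ⊢
    obtain ⟨hkn, hk1, hne⟩ := hk
    by_contra hall
    push Not at hall
    apply hne
    constructor
    · rintro ⟨j, hj⟩
      exact ⟨j, (hall j hkn hk1).1 hj⟩
    · rintro ⟨j, hj⟩
      exact ⟨j, (hall j hkn hk1).2 hj⟩
  calc ((Finset.range n).filter (fun k => k + 1 < n ∧ ¬ ((∃ j, Q j k) ↔ (∃ j, Q j (k + 1))))).card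
      ≤ ((Finset.univ : Finset (Fin N)).biUnion
          (fun j => (Finset.range n).filter (fun k => k + 1 < n ∧ ¬ (Q j k ↔ Q j (k + 1))))).card :=
        Finset.card_le_card hcov
    _ ≤ ∑ j : Fin N, ((Finset.range n).filter (fun k => k + 1 < n ∧ ¬ (Q j k ↔ Q j (k + 1)))).card :=
        Finset.card_biUnion_le
    _ ≤ ∑ _j : Fin N, 2 := Finset.sum_le_sum fun j _ => card_flips_le_two n (Q j) (hQ j)
    _ = 2 * N := by simp [mul_comm]

/-- **double counting of flips**: if every position's membership in `A k` flips at most `2M` times before time `n`, then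
the configurations at consecutive times `k < n'` (`n' + 1 ≤ n`) differ in at most `2M·L` (position, time) incidences. -/
theorem sum_card_flip_le (n : ℕ) (A : ℕ → Finset (Fin L)) (M n' : ℕ) (hn' : n' + 1 ≤ n)
    (hflip : ∀ z : Fin L,
      ((Finset.range n).filter (fun k => k + 1 < n ∧ ¬ (z ∈ A k ↔ z ∈ A (k + 1)))).card ≤ 2 * M) :
    ∑ k ∈ Finset.range n', ((Finset.univ : Finset (Fin L)).filter (fun z => ¬ (z ∈ A k ↔ z ∈ A (k + 1)))).card
      ≤ 2 * M * L := by
  classical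
  have hz : ∀ z : Fin L, ((Finset.range n').filter (fun k => ¬ (z ∈ A k ↔ z ∈ A (k + 1)))).card ≤ 2 * M := by
    intro z
    refine le_trans (Finset.card_le_card ?_) (hflip z)
    intro k hk
    simp only [Finset.mem_filter, Finset.mem_range] at hk ⊢
    exact ⟨by omega, by omega, hk.2⟩
  calc ∑ k ∈ Finset.range n', ((Finset.univ : Finset (Fin L)).filter (fun z => ¬ (z ∈ A k ↔ z ∈ A (k + 1)))).card
      = ∑ k ∈ Finset.range n', ∑ z : Fin L, (if ¬ (z ∈ A k ↔ z ∈ A (k + 1)) then 1 else 0) := by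
        refine Finset.sum_congr rfl fun k _ => ?_
        rw [Finset.card_filter]
    _ = ∑ z : Fin L, ∑ k ∈ Finset.range n', (if ¬ (z ∈ A k ↔ z ∈ A (k + 1)) then 1 else 0) := Finset.sum_comm
    _ = ∑ z : Fin L, ((Finset.range n').filter (fun k => ¬ (z ∈ A k ↔ z ∈ A (k + 1)))).card := by
        refine Finset.sum_congr rfl fun z _ => ?_
        rw [Finset.card_filter]
    _ ≤ ∑ _z : Fin L, 2 * M := Finset.sum_le_sum fun z _ => hz z
    _ = 2 * M * L := by simp [mul_comm]

end Summit.ValiantsHypothesis.ValiantsHypothesis.Theorems.KPlusLogSqLaw.ComparabilityLinear
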